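import Literature.Analysis.UnboundedOperators.LinearizedBoltzmannOperator
import Mathlib.Analysis.Distribution.SchwartzSpace.Basic
import Mathlib.Analysis.InnerProductSpace.LinearPMap
import Mathlib.Topology.Algebra.Module.LinearPMap
import HarnessLib

/-!
# The linearised hard-sphere operator: self-adjointness and the temperate-growth core

Sibling proof file of `LinearizedBoltzmann.lean` (towards the discharge of
`exists_isSelfAdjoint_hasCore`, CIP 1994 §7.2 Thm 7.2.1). For the operator `A = -ν + K` of
`LinearizedBoltzmannOperator` (`linearizedHardSpherePMap hE`, `dom A = {f ∈ L²(M dv) | ν f ∈ L²}`)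
we prove:

* `isSelfAdjoint_linearizedHardSpherePMap` — **`A` is self-adjoint** (CIP 1994 Thm 7.2.1 "the
  linearized collision operator … is self-adjoint … in `L²`"; here: a bounded symmetric
  perturbation of the maximal multiplication operator by the real function `-ν`, which is
  self-adjoint on `{f | ν f ∈ L²}` by Reed–Simon I §VIII.3 Prop. 1 — the truncation argument below
  is theirs — and bounded symmetric perturbations preserve self-adjointness, the trivial case of
  the Kato–Rellich theorem, Kato V §4.1 Thm 4.3). Proof: `A` is symmetric, so `A ≤ A†`
  (`LinearPMap.IsFormalAdjoint.le_adjoint`); conversely for `y ∈ dom A†` the functional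
  `x ↦ ⟪y, ν x⟫` is bounded on `dom A`, and testing it on `x = ν 1_{ν ≤ n} y ∈ dom A` gives
  `∫ ν² 1_{ν ≤ n} y² ≤ C²` for all `n`, whence `ν y ∈ L²` by monotone convergence.
* `dense_linearizedDomain` — `dom A` is dense (it contains the Schwartz classes, which are dense
  in `L²(M dv)`, `SchwartzMap.denseRange_toLpCLM`).
* `temperateSubmodule` — the submodule `S` of `L²(M dv)` of classes of functions of temperate
  growth, `temperateSubmodule_le_linearizedDomain : S ≤ dom A`, and
  `exists_schwartz_graph_approx` — **every `f ∈ dom A` is a graph-norm limit of Schwartz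
  classes**: Schwartz functions are dense in `L²((1 + ν)² M dv)` (a finite measure), and
  `‖u‖_M, ‖ν u‖_M ≤ ‖(1 + ν) u‖_M`;
* `hasCore_linearizedHardSpherePMap` — **`S` is a core of `A`** (Mathlib's `LinearPMap.HasCore`:
  `S ≤ dom A` and the closure of `A|S` is `A`).

## References

* C. Cercignani, R. Illner, M. Pulvirenti, *The Mathematical Theory of Dilute Gases*, Springer
  (1994), §7.2 Thm 7.2.1 p. 197.
* M. Reed, B. Simon, *Methods of Modern Mathematical Physics I: Functional Analysis*, Academic
  Press (1972/1980), §VIII.2 (Definition p. 256: cores) and §VIII.3 Prop. 1 p. 259 (the maximal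
  multiplication operator `T_f`, `D(T_f) = {φ | fφ ∈ L²}`, by a real measurable `f` on a finite
  measure space is self-adjoint; proof by the truncations `χ_N = 1_{|f| ≤ N}`).
* T. Kato, *Perturbation Theory for Linear Operators*, Springer (1966), V §4.1 Thm 4.3
  (Kato–Rellich).
-/

open MeasureTheory Metric Real Set Filter Topology ProbabilityTheory Module
open scoped InnerProductSpace ENNReal SchwartzMap

namespace Literature.Analysis.UnboundedOperators

noncomputable section

open Literature.MathematicalPhysics.KineticTheory (sphereMeasure hardSphereKernel)
open Literature.Analysis.FluidPDE
open LinearPMap (adjoint)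

variable {E : Type*} [NormedAddCommGroup E] [InnerProductSpace ℝ E] [FiniteDimensional ℝ E]
  [MeasurableSpace E] [BorelSpace E]

/-! ### Weighted `L²` membership of polynomially bounded functions -/

section Moments

/-- `(1 + |v|)^m ∈ L²(M dv)`. [folklore] -/
theorem memLp_two_one_add_norm_pow (m : ℕ) :
    MemLp (fun v : E => (1 + ‖v‖) ^ m) 2 (stdGaussian E) := by
  rw [memLp_two_iff_integrable_sq (by fun_prop : Continuous fun v : E =>
    (1 + ‖v‖) ^ m).aestronglyMeasurable]
  simpa only [← pow_mul] using integrable_one_add_norm_pow_stdGaussian (E := E) (m * 2)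

/-- A measurable function with `|f(v)| ≤ C (1 + |v|)^m` is in `L²(M dv)`. [folklore] -/
theorem memLp_two_of_abs_le_pow {f : E → ℝ} (hf : AEStronglyMeasurable f (stdGaussian E))
    {C : ℝ} {m : ℕ} (hle : ∀ v, |f v| ≤ C * (1 + ‖v‖) ^ m) : MemLp f 2 (stdGaussian E) := by
  refine ((memLp_two_one_add_norm_pow (E := E) m).const_mul C).of_le hf
    (Eventually.of_forall fun v => ?_)
  rw [Real.norm_eq_abs, Real.norm_eq_abs]
  exact (hle v).trans (le_abs_self _)

/-- A function of temperate growth is in `L²(M dv)`. [folklore] -/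
theorem memLp_two_of_hasTemperateGrowth {g : E → ℝ} (hg : g.HasTemperateGrowth) :
    MemLp g 2 (stdGaussian E) := by
  obtain ⟨k, C, -, hC⟩ := exists_abs_le_of_hasTemperateGrowth hg
  exact memLp_two_of_abs_le_pow hg.1.continuous.aestronglyMeasurable hC

/-- `ν g ∈ L²(M dv)` for `g` of temperate growth (`ν(v) ≤ C_ν (1 + |v|)`). [folklore] -/
theorem memLp_two_collisionFrequency_mul_of_hasTemperateGrowth {g : E → ℝ}
    (hg : g.HasTemperateGrowth) :
    MemLp (fun v => collisionFrequency v * g v) 2 (stdGaussian E) := by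
  obtain ⟨k, C, hC0, hC⟩ := exists_abs_le_of_hasTemperateGrowth hg
  refine memLp_two_of_abs_le_pow (measurable_collisionFrequency.aestronglyMeasurable.mul
    hg.1.continuous.aestronglyMeasurable) (C := frequencyConst E * C) (m := k + 1) fun v => ?_
  calc |collisionFrequency v * g v| ≤ frequencyConst E * (1 + ‖v‖) * |g v| :=
        abs_collisionFrequency_mul_le v (g v)
    _ ≤ frequencyConst E * (1 + ‖v‖) * (C * (1 + ‖v‖) ^ k) :=
        mul_le_mul_of_nonneg_left (hC v) (mul_nonneg frequencyConst_nonneg (by positivity))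
    _ = frequencyConst E * C * (1 + ‖v‖) ^ (k + 1) := by ring

end Moments

/-! ### The temperate-growth submodule and the density of the domain -/

section Temperate

/-- **The submodule `S` of `L²(M dv)` of classes of functions of temperate growth** (smooth with
polynomially bounded derivatives, Mathlib's `Function.HasTemperateGrowth`; these are the `g` on
which `LinearizedBoltzmann.hardSphereLinearizedOp g` is given by convergent integrals). It
contains the Schwartz classes, hence is dense (CIP 1994 §7.1: `L` is "defined on a dense
subset"). [cite: CIPDiluteGases1994, §7.1 (7.1.6)] -/
def temperateSubmodule : Submodule ℝ (Lp ℝ 2 (stdGaussian E)) where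
  carrier := {f | ∃ g : E → ℝ, g.HasTemperateGrowth ∧ (f : E → ℝ) =ᵐ[stdGaussian E] g}
  zero_mem' := ⟨0, Function.HasTemperateGrowth.zero, Lp.coeFn_zero ℝ 2 (stdGaussian E)⟩
  add_mem' := by
    rintro f₁ f₂ ⟨g₁, hg₁, h₁⟩ ⟨g₂, hg₂, h₂⟩
    refine ⟨g₁ + g₂, hg₁.add hg₂, ?_⟩
    filter_upwards [Lp.coeFn_add f₁ f₂, h₁, h₂] with v hv hv₁ hv₂
    simp only [hv, Pi.add_apply, hv₁, hv₂]
  smul_mem' := by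
    rintro c f ⟨g, hg, h⟩
    refine ⟨fun v => c * g v, (Function.HasTemperateGrowth.const c).mul hg, ?_⟩
    filter_upwards [Lp.coeFn_smul c f, h] with v hv hv'
    simp only [hv, Pi.smul_apply, hv', smul_eq_mul]

omit [BorelSpace E] in
/-- Membership in `S`. [folklore] -/
theorem mem_temperateSubmodule_iff {f : Lp ℝ 2 (stdGaussian E)} :
    f ∈ temperateSubmodule ↔
      ∃ g : E → ℝ, g.HasTemperateGrowth ∧ (f : E → ℝ) =ᵐ[stdGaussian E] g :=
  Iff.rfl

/-- The class of a function of temperate growth lies in `S`. [folklore] -/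
theorem toLp_mem_temperateSubmodule {g : E → ℝ} (hg : g.HasTemperateGrowth) :
    (memLp_two_of_hasTemperateGrowth hg).toLp g ∈ temperateSubmodule :=
  ⟨g, hg, MemLp.coeFn_toLp _⟩

/-- **`S ≤ dom A`**: classes of temperate growth have `ν f ∈ L²`. [folklore] -/
theorem temperateSubmodule_le_linearizedDomain :
    temperateSubmodule (E := E) ≤ linearizedDomain := by
  rintro f ⟨g, hg, hfg⟩
  exact mem_linearizedDomain_of_ae_eq hfg (memLp_two_collisionFrequency_mul_of_hasTemperateGrowth hg)

/-- The Schwartz class `[s] ∈ S`. [folklore] -/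
theorem schwartz_toLp_mem_temperateSubmodule (s : 𝓢(E, ℝ)) :
    s.toLp 2 (stdGaussian E) ∈ temperateSubmodule :=
  ⟨s, s.hasTemperateGrowth, s.coeFn_toLp 2 (stdGaussian E)⟩

/-- The Schwartz class `[s] ∈ dom A`. [folklore] -/
theorem schwartz_toLp_mem_linearizedDomain (s : 𝓢(E, ℝ)) :
    s.toLp 2 (stdGaussian E) ∈ linearizedDomain :=
  temperateSubmodule_le_linearizedDomain (schwartz_toLp_mem_temperateSubmodule s)

/-- `S` is dense in `L²(M dv)` (Schwartz functions are dense in `L²` of the finite measure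
`M dv`, `SchwartzMap.denseRange_toLpCLM`). [folklore] -/
theorem dense_temperateSubmodule :
    Dense (temperateSubmodule (E := E) : Set (Lp ℝ 2 (stdGaussian E))) := by
  have h := SchwartzMap.denseRange_toLpCLM (E := E) (F := ℝ) (p := 2) (μ := stdGaussian E)
    ENNReal.ofNat_ne_top
  refine h.mono ?_
  rintro _ ⟨s, rfl⟩
  exact schwartz_toLp_mem_temperateSubmodule s

/-- **`dom A` is dense in `L²(M dv)`.** [folklore] -/
theorem dense_linearizedDomain :
    Dense (linearizedDomain (E := E) : Set (Lp ℝ 2 (stdGaussian E))) :=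
  dense_temperateSubmodule.mono fun _ hf => temperateSubmodule_le_linearizedDomain hf

end Temperate

/-! ### Self-adjointness -/

section SelfAdjoint

/-- `⟪y, ν x⟫ = ∫ y ν x dM` for `x ∈ dom A`, `y ∈ L²(M dv)`. [folklore] -/
theorem inner_mulFrequency_eq_integral (y : Lp ℝ 2 (stdGaussian E)) (x : linearizedDomain (E := E)) :
    ⟪y, mulFrequency x⟫_ℝ = ∫ v, (y : E → ℝ) v * (collisionFrequency v * (x : E → ℝ) v)
      ∂stdGaussian E := by
  rw [L2.inner_def]
  refine integral_congr_ae ?_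
  filter_upwards [coeFn_mulFrequency x] with v hv
  rw [hv]
  simp only [RCLike.inner_apply, conj_trivial]
  ring

/-- The truncated test functions `u_n = ν 1_{ν ≤ n} y` of the self-adjointness proof: `u_n` and
`ν u_n` are in `L²(M dv)` (`|u_n| ≤ n |y|`, `|ν u_n| ≤ n² |y|`). [folklore] -/
theorem memLp_truncTest (y : Lp ℝ 2 (stdGaussian E)) (n : ℕ) :
    MemLp (fun v => ({v | collisionFrequency v ≤ n} : Set E).indicator
        (fun v => collisionFrequency v * (y : E → ℝ) v) v) 2 (stdGaussian E) ∧
      MemLp (fun v => collisionFrequency v * ({v | collisionFrequency v ≤ n} : Set E).indicator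
        (fun v => collisionFrequency v * (y : E → ℝ) v) v) 2 (stdGaussian E) := by
  have hmeas : MeasurableSet ({v | collisionFrequency v ≤ n} : Set E) :=
    measurableSet_le measurable_collisionFrequency measurable_const
  have hνy : AEStronglyMeasurable (fun v => collisionFrequency v * (y : E → ℝ) v) (stdGaussian E) :=
    measurable_collisionFrequency.aestronglyMeasurable.mul (Lp.aestronglyMeasurable y)
  have h1 : AEStronglyMeasurable (fun v => ({v | collisionFrequency v ≤ n} : Set E).indicator
      (fun v => collisionFrequency v * (y : E → ℝ) v) v) (stdGaussian E) := hνy.indicator hmeas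
  constructor
  · refine ((Lp.memLp y).const_mul (n : ℝ)).of_le h1 (Eventually.of_forall fun v => ?_)
    rw [Real.norm_eq_abs, Real.norm_eq_abs]
    by_cases hv : collisionFrequency v ≤ n
    · rw [Set.indicator_of_mem (show v ∈ {v | collisionFrequency v ≤ (n : ℝ)} from hv), abs_mul,
        abs_mul, abs_of_nonneg (collisionFrequency_nonneg v), Nat.abs_cast]
      exact mul_le_mul_of_nonneg_right hv (abs_nonneg _)
    · rw [Set.indicator_of_notMem (show v ∉ {v | collisionFrequency v ≤ (n : ℝ)} from hv), abs_zero]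
      positivity
  · refine ((Lp.memLp y).const_mul ((n : ℝ) * n)).of_le
      (measurable_collisionFrequency.aestronglyMeasurable.mul h1) (Eventually.of_forall fun v => ?_)
    rw [Real.norm_eq_abs, Real.norm_eq_abs]
    by_cases hv : collisionFrequency v ≤ n
    · rw [Set.indicator_of_mem (show v ∈ {v | collisionFrequency v ≤ (n : ℝ)} from hv), abs_mul,
        abs_mul, abs_mul, abs_mul, abs_of_nonneg (collisionFrequency_nonneg v), Nat.abs_cast]
      have h0 := collisionFrequency_nonneg v
      calc collisionFrequency v * (collisionFrequency v * |(y : E → ℝ) v|)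
          ≤ n * (n * |(y : E → ℝ) v|) :=
            mul_le_mul hv (mul_le_mul_of_nonneg_right hv (abs_nonneg _)) (by positivity)
              (Nat.cast_nonneg n)
        _ = (n * n) * |(y : E → ℝ) v| := by ring
    · rw [Set.indicator_of_notMem (show v ∉ {v | collisionFrequency v ≤ (n : ℝ)} from hv), mul_zero,
        abs_zero]
      positivity

/-- **`dom A† ≤ dom A`**: if `x ↦ ⟪y, A x⟫` is continuous on `dom A` then `ν y ∈ L²(M dv)`
(test on `x_n = ν 1_{ν ≤ n} y`, for which `⟪y, ν x_n⟫ = ‖x_n‖²`, and let `n → ∞` by monotone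
convergence — the truncation argument of Reed–Simon I §VIII.3 Prop. 1, p. 259, for the maximal
multiplication operator, unaffected by the bounded symmetric `K`). [cite: ReedSimonI1980, §VIII.3 Prop. 1 p. 259] -/
theorem adjoint_domain_le (hE : 2 ≤ finrank ℝ E) :
    (linearizedHardSpherePMap hE).adjoint.domain ≤ (linearizedHardSpherePMap hE).domain := by
  intro y hy
  set A := linearizedHardSpherePMap hE with hA
  -- the bound `|⟪y, ν x⟫| ≤ C ‖x‖` on `dom A`
  rw [LinearPMap.mem_adjoint_domain_iff] at hy
  set L : A.domain →L[ℝ] ℝ := ⟨(innerₛₗ ℝ y).comp A.toFun, hy⟩ with hL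
  have hLx : ∀ x : A.domain, L x = ⟪y, A x⟫_ℝ := fun x => rfl
  set C : ℝ := ‖L‖ + ‖gainLossOp hE‖ * ‖y‖ with hC
  have hC0 : 0 ≤ C := by positivity
  have hbound : ∀ x : A.domain, |⟪y, mulFrequency x⟫_ℝ| ≤ C * ‖(x : Lp ℝ 2 (stdGaussian E))‖ := by
    intro x
    have h1 : |⟪y, A x⟫_ℝ| ≤ ‖L‖ * ‖(x : Lp ℝ 2 (stdGaussian E))‖ := by
      rw [← hLx, ← Real.norm_eq_abs]
      exact L.le_opNorm x
    have h2 : |⟪y, gainLossOp hE (x : Lp ℝ 2 (stdGaussian E))⟫_ℝ| ≤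
        ‖gainLossOp hE‖ * ‖y‖ * ‖(x : Lp ℝ 2 (stdGaussian E))‖ := by
      refine (abs_real_inner_le_norm _ _).trans ?_
      rw [mul_comm ‖gainLossOp hE‖ ‖y‖, mul_assoc]
      exact mul_le_mul_of_nonneg_left (ContinuousLinearMap.le_opNorm _ _) (norm_nonneg _)
    have h3 : ⟪y, mulFrequency x⟫_ℝ = -⟪y, A x⟫_ℝ + ⟪y, gainLossOp hE (x : Lp ℝ 2 (stdGaussian E))⟫_ℝ := by
      rw [show (A x : Lp ℝ 2 (stdGaussian E)) =
          -mulFrequency x + gainLossOp hE (x : Lp ℝ 2 (stdGaussian E)) from rfl,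
        inner_add_right, inner_neg_right]
      ring
    rw [h3, hC]
    calc |-⟪y, A x⟫_ℝ + ⟪y, gainLossOp hE (x : Lp ℝ 2 (stdGaussian E))⟫_ℝ|
        ≤ |⟪y, A x⟫_ℝ| + |⟪y, gainLossOp hE (x : Lp ℝ 2 (stdGaussian E))⟫_ℝ| := by
          refine (abs_add_le _ _).trans ?_; rw [abs_neg]
      _ ≤ _ := by nlinarith [h1, h2]
  -- the test functions
  set ν : E → ℝ := collisionFrequency with hν
  set u : ℕ → E → ℝ := fun n v =>
    ({v | ν v ≤ n} : Set E).indicator (fun v => ν v * (y : E → ℝ) v) v with hu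
  have hu_mem := fun n => memLp_truncTest y n
  set x : ℕ → Lp ℝ 2 (stdGaussian E) := fun n => (hu_mem n).1.toLp (u n) with hx
  have hxu : ∀ n, (x n : E → ℝ) =ᵐ[stdGaussian E] u n := fun n => MemLp.coeFn_toLp _
  have hxD : ∀ n, x n ∈ A.domain := fun n =>
    mem_linearizedDomain_of_ae_eq (hxu n) (hu_mem n).2
  -- `⟪y, ν x_n⟫ = ‖x_n‖²`
  have hkey : ∀ n, ⟪y, mulFrequency (⟨x n, hxD n⟩ : A.domain)⟫_ℝ = ‖x n‖ ^ 2 := by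
    intro n
    rw [inner_mulFrequency_eq_integral, ← real_inner_self_eq_norm_sq, L2.inner_def]
    refine integral_congr_ae ?_
    filter_upwards [hxu n] with v hv
    simp only [RCLike.inner_apply, conj_trivial, hv, hu]
    by_cases hvn : ν v ≤ n
    · rw [Set.indicator_of_mem (show v ∈ {v | ν v ≤ (n : ℝ)} from hvn)]; ring
    · rw [Set.indicator_of_notMem (show v ∉ {v | ν v ≤ (n : ℝ)} from hvn)]; ring
  -- hence `‖x_n‖ ≤ C`
  have hxle : ∀ n, ‖x n‖ ≤ C := by
    intro n
    have h := hbound ⟨x n, hxD n⟩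
    rw [hkey n, Submodule.coe_mk, abs_of_nonneg (sq_nonneg _)] at h
    by_cases h0 : ‖x n‖ = 0
    · rw [h0]; exact hC0
    · exact le_of_mul_le_mul_right (by nlinarith [h]) ((norm_nonneg _).lt_of_ne (Ne.symm h0))
  -- in `ℝ≥0∞`: `eLpNorm (u n) 2 ≤ C`
  have hsnorm : ∀ n, eLpNorm (u n) 2 (stdGaussian E) ≤ ENNReal.ofReal C := by
    intro n
    rw [← eLpNorm_congr_ae (hxu n), ← ENNReal.ofReal_toReal (Lp.memLp (x n)).eLpNorm_ne_top,
      ← Lp.norm_def]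
    exact ENNReal.ofReal_le_ofReal (hxle n)
  -- monotone convergence: `∫ |ν y|² = sup_n ∫ |u_n|² ≤ C²`
  have hνy_meas : AEStronglyMeasurable (fun v => ν v * (y : E → ℝ) v) (stdGaussian E) :=
    measurable_collisionFrequency.aestronglyMeasurable.mul (Lp.aestronglyMeasurable y)
  have hmono : ∀ v, Monotone fun n => ‖u n v‖ₑ ^ (2 : ℝ) := by
    intro v m n hmn
    refine ENNReal.rpow_le_rpow ?_ (by norm_num)
    simp only [hu]
    by_cases hvm : ν v ≤ m
    · rw [Set.indicator_of_mem (show v ∈ {v | ν v ≤ (m : ℝ)} from hvm),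
        Set.indicator_of_mem (show v ∈ {v | ν v ≤ (n : ℝ)} from hvm.trans (by exact_mod_cast hmn))]
    · rw [Set.indicator_of_notMem (show v ∉ {v | ν v ≤ (m : ℝ)} from hvm)]
      simp
  have hsup : ∀ v, (⨆ n, ‖u n v‖ₑ ^ (2 : ℝ)) = ‖ν v * (y : E → ℝ) v‖ₑ ^ (2 : ℝ) := by
    intro v
    obtain ⟨N, hN⟩ := exists_nat_ge (ν v)
    refine le_antisymm (iSup_le fun n => ENNReal.rpow_le_rpow ?_ (by norm_num)) ?_
    · simp only [hu]
      by_cases hvn : ν v ≤ n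
      · rw [Set.indicator_of_mem (show v ∈ {v | ν v ≤ (n : ℝ)} from hvn)]
      · rw [Set.indicator_of_notMem (show v ∉ {v | ν v ≤ (n : ℝ)} from hvn)]; simp
    · refine le_iSup_of_le N (le_of_eq ?_)
      simp only [hu]
      rw [Set.indicator_of_mem (show v ∈ {v | ν v ≤ (N : ℝ)} from hN)]
  have hlin : ∫⁻ v, ‖ν v * (y : E → ℝ) v‖ₑ ^ (2 : ℝ) ∂stdGaussian E ≤ ENNReal.ofReal C ^ (2 : ℝ) := by
    calc ∫⁻ v, ‖ν v * (y : E → ℝ) v‖ₑ ^ (2 : ℝ) ∂stdGaussian E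
        = ∫⁻ v, ⨆ n, ‖u n v‖ₑ ^ (2 : ℝ) ∂stdGaussian E := by simp_rw [hsup]
      _ = ⨆ n, ∫⁻ v, ‖u n v‖ₑ ^ (2 : ℝ) ∂stdGaussian E :=
          lintegral_iSup' (fun n => ((hu_mem n).1.1.enorm.pow_const _))
            (Eventually.of_forall hmono)
      _ ≤ ENNReal.ofReal C ^ (2 : ℝ) := by
          refine iSup_le fun n => ?_
          have h := ENNReal.rpow_le_rpow (hsnorm n) (by norm_num : (0 : ℝ) ≤ 2)
          rwa [eLpNorm_eq_lintegral_rpow_enorm_toReal two_ne_zero ENNReal.ofNat_ne_top,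
            ENNReal.toReal_ofNat, ← ENNReal.rpow_mul, show 1 / (2 : ℝ) * 2 = 1 by norm_num,
            ENNReal.rpow_one] at h
  -- conclude `ν y ∈ L²`
  change MemLp (fun v => ν v * (y : E → ℝ) v) 2 (stdGaussian E)
  refine ⟨hνy_meas, ?_⟩
  rw [eLpNorm_eq_lintegral_rpow_enorm_toReal two_ne_zero ENNReal.ofNat_ne_top, ENNReal.toReal_ofNat]
  refine ENNReal.rpow_lt_top_of_nonneg (by norm_num) (lt_of_le_of_lt hlin ?_).ne
  exact ENNReal.rpow_lt_top_of_nonneg (by norm_num) ENNReal.ofReal_ne_top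

/-- **The linearised hard-sphere operator `A = -ν + K` is self-adjoint on `L²(M dv)`**
(CIP 1994 §7.2 Thm 7.2.1: "the linearized collision operator … is self-adjoint … in `L²`", with
§7.1 "taken with its maximal domain in `L²`"; a bounded symmetric perturbation of the self-adjoint
maximal multiplication operator, Reed–Simon I §VIII.3 Prop. 1 and Kato V §4.1 Thm 4.3).
[cite: CIPDiluteGases1994, §7.2 Thm 7.2.1] -/
theorem isSelfAdjoint_linearizedHardSpherePMap (hE : 2 ≤ finrank ℝ E) :
    IsSelfAdjoint (linearizedHardSpherePMap hE) := by
  have hdense : Dense ((linearizedHardSpherePMap hE).domain : Set (Lp ℝ 2 (stdGaussian E))) :=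
    dense_linearizedDomain
  have hle : linearizedHardSpherePMap hE ≤ (linearizedHardSpherePMap hE).adjoint :=
    (isFormalAdjoint_linearizedHardSpherePMap hE).le_adjoint hdense
  have heq : (linearizedHardSpherePMap hE).domain = (linearizedHardSpherePMap hE).adjoint.domain :=
    le_antisymm hle.1 (adjoint_domain_le hE)
  rw [LinearPMap.isSelfAdjoint_def]
  exact (LinearPMap.eq_of_le_of_domain_eq hle heq).symm

end SelfAdjoint

/-! ### Graph-norm approximation by Schwartz classes and the core property -/

section Core

/-- The weighted norm controls the graph norm pointwise: `|u| ≤ (1 + ν) |u|` and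
`|ν u| ≤ (1 + ν) |u|`. [folklore] -/
theorem abs_le_one_add_collisionFrequency_mul (v : E) (u : ℝ) :
    |u| ≤ |(1 + collisionFrequency v) * u| ∧
      |collisionFrequency v * u| ≤ |(1 + collisionFrequency v) * u| := by
  have h0 := collisionFrequency_nonneg v
  rw [abs_mul, abs_mul, abs_of_nonneg h0,
    abs_of_nonneg (show (0 : ℝ) ≤ 1 + collisionFrequency v by linarith)]
  exact ⟨by nlinarith [abs_nonneg u], by nlinarith [abs_nonneg u]⟩

/-- The weighted measure `(1 + ν)² M dv` is finite (`ν ≤ C_ν (1 + |v|)` and Gaussian moments).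
[folklore] -/
theorem isFiniteMeasure_withDensity_weight :
    IsFiniteMeasure ((stdGaussian E).withDensity fun v =>
      ENNReal.ofReal ((1 + collisionFrequency v) ^ 2)) := by
  refine isFiniteMeasure_withDensity_ofReal ?_
  have hint : Integrable (fun v : E => (1 + frequencyConst E) ^ 2 * (1 + ‖v‖) ^ 2) (stdGaussian E) :=
    (integrable_one_add_norm_pow_stdGaussian 2).const_mul _
  refine (hint.mono' ((measurable_collisionFrequency.const_add 1).pow_const 2).aestronglyMeasurable
    (Eventually.of_forall fun v => ?_)).hasFiniteIntegral
  have h0 := collisionFrequency_nonneg v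
  have h1 := collisionFrequency_le v
  have hC := frequencyConst_nonneg (E := E)
  rw [Real.norm_of_nonneg (by positivity), ← mul_pow]
  refine pow_le_pow_left₀ (by positivity) ?_ 2
  nlinarith [norm_nonneg v, mul_nonneg hC (norm_nonneg v)]

/-- `‖u‖_{L²((1+ν)² M)} = ‖(1 + ν) u‖_{L²(M)}`. [folklore] -/
theorem eLpNorm_withDensity_weight {u : E → ℝ} (hu : AEStronglyMeasurable u (stdGaussian E)) :
    eLpNorm u 2 ((stdGaussian E).withDensity fun v => ENNReal.ofReal ((1 + collisionFrequency v) ^ 2)) =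
      eLpNorm (fun v => (1 + collisionFrequency v) * u v) 2 (stdGaussian E) := by
  have hw : Measurable fun v : E => ENNReal.ofReal ((1 + collisionFrequency v) ^ 2) :=
    ((measurable_collisionFrequency.const_add 1).pow_const 2).ennreal_ofReal
  rw [eLpNorm_eq_lintegral_rpow_enorm_toReal two_ne_zero ENNReal.ofNat_ne_top,
    eLpNorm_eq_lintegral_rpow_enorm_toReal two_ne_zero ENNReal.ofNat_ne_top, ENNReal.toReal_ofNat,
    lintegral_withDensity_eq_lintegral_mul₀ hw.aemeasurable (hu.enorm.pow_const _)]
  congr 1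
  refine lintegral_congr fun v => ?_
  have h1 : (0 : ℝ) ≤ 1 + collisionFrequency v := by linarith [collisionFrequency_nonneg v]
  simp only [Pi.mul_apply, ENNReal.rpow_two]
  rw [enorm_mul, mul_pow, Real.enorm_eq_ofReal h1, ENNReal.ofReal_pow h1]

/-- **Graph-norm approximation by Schwartz classes.** For `f ∈ dom A` and `ε > 0` there is a
Schwartz function `s` with `‖[s] - f‖ < ε` and `‖ν [s] - ν f‖ < ε` (Schwartz functions are dense
in `L²((1 + ν)² M dv)`, `SchwartzMap.denseRange_toLpCLM`, and `‖u‖_M, ‖ν u‖_M ≤ ‖(1 + ν) u‖_M`).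
[folklore] -/
theorem exists_schwartz_approx (f : linearizedDomain (E := E)) {ε : ℝ} (hε : 0 < ε) :
    ∃ s : 𝓢(E, ℝ), ‖s.toLp 2 (stdGaussian E) - (f : Lp ℝ 2 (stdGaussian E))‖ < ε ∧
      ‖mulFrequency ⟨s.toLp 2 (stdGaussian E), schwartz_toLp_mem_linearizedDomain s⟩ -
        mulFrequency f‖ < ε := by
  set μ' : Measure E := (stdGaussian E).withDensity fun v =>
    ENNReal.ofReal ((1 + collisionFrequency v) ^ 2) with hμ'
  haveI : IsFiniteMeasure μ' := isFiniteMeasure_withDensity_weight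
  have hac : μ' ≪ stdGaussian E := withDensity_absolutelyContinuous _ _
  -- `f ∈ L²(μ')`
  have hfm : AEStronglyMeasurable (f : E → ℝ) μ' :=
    (Lp.aestronglyMeasurable (f : Lp ℝ 2 (stdGaussian E))).mono_ac hac
  have hf' : MemLp (f : E → ℝ) 2 μ' := by
    refine ⟨hfm, ?_⟩
    rw [hμ', eLpNorm_withDensity_weight (Lp.aestronglyMeasurable _)]
    have h : MemLp (fun v => (1 + collisionFrequency v) * (f : E → ℝ) v) 2 (stdGaussian E) := by
      have := (Lp.memLp (f : Lp ℝ 2 (stdGaussian E))).add (f.2 : MemLp _ 2 _)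
      refine this.congr_norm ?_ ?_  -- same norm pointwise
      · exact ((measurable_collisionFrequency.const_add 1).aestronglyMeasurable).mul
          (Lp.aestronglyMeasurable _)
      · exact Eventually.of_forall fun v => by simp only [Pi.add_apply]; ring_nf
    exact h.eLpNorm_lt_top
  -- Schwartz approximation in `L²(μ')`
  have hd := SchwartzMap.denseRange_toLpCLM (E := E) (F := ℝ) (p := 2) (μ := μ') ENNReal.ofNat_ne_top
  obtain ⟨s, hs⟩ := hd.exists_dist_lt (hf'.toLp _) hε
  have hsm : AEStronglyMeasurable (s : E → ℝ) (stdGaussian E) := s.continuous.aestronglyMeasurable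
  set D : E → ℝ := fun v => s v - (f : E → ℝ) v with hD
  have hDm : AEStronglyMeasurable D (stdGaussian E) := hsm.sub (Lp.aestronglyMeasurable _)
  -- `‖(1 + ν) (s - f)‖_M = ‖[s] - [f]‖_{L²(μ')} < ε`
  have hdist : (eLpNorm (fun v => (1 + collisionFrequency v) * D v) 2 (stdGaussian E)).toReal < ε := by
    rw [← eLpNorm_withDensity_weight hDm]
    have h1 : eLpNorm D 2 μ' = eLpNorm (⇑(s.toLp 2 μ' - hf'.toLp (f : E → ℝ))) 2 μ' := by
      refine eLpNorm_congr_ae ?_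
      filter_upwards [Lp.coeFn_sub (s.toLp 2 μ') (hf'.toLp _), s.coeFn_toLp 2 μ',
        hf'.coeFn_toLp] with v h1 h2 h3
      rw [h1, Pi.sub_apply, h2, h3]
    rw [h1, ← Lp.norm_def, ← dist_eq_norm, dist_comm]
    simpa only [SchwartzMap.toLpCLM_apply] using hs
  have hfin : eLpNorm (fun v => (1 + collisionFrequency v) * D v) 2 (stdGaussian E) ≠ ∞ := by
    rw [← eLpNorm_withDensity_weight hDm]
    exact ((s.memLp 2 μ').sub hf').eLpNorm_ne_top
  have hbound : ∀ {u : E → ℝ}, (∀ v, ‖u v‖ ≤ ‖(1 + collisionFrequency v) * D v‖) →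
      (eLpNorm u 2 (stdGaussian E)).toReal < ε := fun hu =>
    lt_of_le_of_lt (ENNReal.toReal_mono hfin (eLpNorm_mono_ae (Eventually.of_forall hu))) hdist
  refine ⟨s, ?_, ?_⟩
  · have h1 : ‖s.toLp 2 (stdGaussian E) - (f : Lp ℝ 2 (stdGaussian E))‖ =
        (eLpNorm D 2 (stdGaussian E)).toReal := by
      rw [Lp.norm_def]
      congr 1
      refine eLpNorm_congr_ae ?_
      filter_upwards [Lp.coeFn_sub (s.toLp 2 (stdGaussian E)) (f : Lp ℝ 2 (stdGaussian E)),
        s.coeFn_toLp 2 (stdGaussian E)] with v h1 h2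
      rw [h1, Pi.sub_apply, h2]
    rw [h1]
    refine hbound fun v => ?_
    rw [Real.norm_eq_abs, Real.norm_eq_abs]
    exact (abs_le_one_add_collisionFrequency_mul v (D v)).1
  · rw [← map_sub]
    have h1 : ‖mulFrequency (⟨s.toLp 2 (stdGaussian E), schwartz_toLp_mem_linearizedDomain s⟩ - f)‖ =
        (eLpNorm (fun v => collisionFrequency v * D v) 2 (stdGaussian E)).toReal := by
      rw [Lp.norm_def]
      congr 1
      refine eLpNorm_congr_ae ?_
      filter_upwards [coeFn_mulFrequency
          (⟨s.toLp 2 (stdGaussian E), schwartz_toLp_mem_linearizedDomain s⟩ - f),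
        Lp.coeFn_sub (s.toLp 2 (stdGaussian E)) (f : Lp ℝ 2 (stdGaussian E)),
        s.coeFn_toLp 2 (stdGaussian E)] with v h1 h2 h3
      rw [h1, Submodule.coe_sub, h2, Pi.sub_apply, h3]
    rw [h1]
    refine hbound fun v => ?_
    rw [Real.norm_eq_abs, Real.norm_eq_abs]
    exact (abs_le_one_add_collisionFrequency_mul v (D v)).2

/-- **Graph-norm approximation**: for `f ∈ dom A` and `ε > 0` there is a Schwartz class `[s]`
with `‖[s] - f‖ < ε` and `‖A [s] - A f‖ < ε` (`A = -ν + K` with `K` bounded). [folklore] -/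
theorem exists_schwartz_graph_approx (hE : 2 ≤ finrank ℝ E)
    (f : linearizedDomain (E := E)) {ε : ℝ} (hε : 0 < ε) :
    ∃ s : 𝓢(E, ℝ), ‖s.toLp 2 (stdGaussian E) - (f : Lp ℝ 2 (stdGaussian E))‖ < ε ∧
      ‖linearizedHardSpherePMap hE
          (⟨s.toLp 2 (stdGaussian E), schwartz_toLp_mem_linearizedDomain s⟩ : linearizedDomain (E := E)) -
        linearizedHardSpherePMap hE f‖ < ε := by
  set K := gainLossOp hE with hK
  set δ : ℝ := ε / (2 + ‖K‖) with hδ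
  have hK0 : 0 ≤ ‖K‖ := norm_nonneg _
  have hδ0 : 0 < δ := div_pos hε (by positivity)
  have hδ1 : δ ≤ ε := by
    rw [hδ, div_le_iff₀ (by positivity)]; nlinarith
  have hδ2 : δ * (1 + ‖K‖) < ε := by
    rw [hδ, div_mul_eq_mul_div, div_lt_iff₀ (by positivity)]; nlinarith
  obtain ⟨s, hs1, hs2⟩ := exists_schwartz_approx (E := E) f hδ0
  refine ⟨s, hs1.trans_le hδ1, ?_⟩
  set g : linearizedDomain (E := E) :=
    ⟨s.toLp 2 (stdGaussian E), schwartz_toLp_mem_linearizedDomain s⟩ with hg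
  have hsub : linearizedHardSpherePMap hE g - linearizedHardSpherePMap hE f =
      -(mulFrequency g - mulFrequency f) + K ((g : Lp ℝ 2 (stdGaussian E)) - f) := by
    rw [linearizedHardSpherePMap_apply, linearizedHardSpherePMap_apply, map_sub]; abel
  rw [hsub]
  have hgf : ‖(g : Lp ℝ 2 (stdGaussian E)) - f‖ < δ := hs1
  calc ‖-(mulFrequency g - mulFrequency f) + K ((g : Lp ℝ 2 (stdGaussian E)) - f)‖
      ≤ ‖mulFrequency g - mulFrequency f‖ + ‖K‖ * ‖(g : Lp ℝ 2 (stdGaussian E)) - f‖ := by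
        refine (norm_add_le _ _).trans (add_le_add (by rw [norm_neg]) (K.le_opNorm _))
    _ < δ + ‖K‖ * δ := by
        have h2 : ‖K‖ * ‖(g : Lp ℝ 2 (stdGaussian E)) - f‖ ≤ ‖K‖ * δ :=
          mul_le_mul_of_nonneg_left hgf.le hK0
        linarith [hs2]
    _ = δ * (1 + ‖K‖) := by ring
    _ < ε := hδ2

/-- The closure of a closed operator is itself. [folklore] -/
theorem closure_eq_of_isClosed {F : Type*} [NormedAddCommGroup F] [InnerProductSpace ℝ F]
    {T : F →ₗ.[ℝ] F} (hT : T.IsClosed) : T.closure = T := by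
  refine LinearPMap.eq_of_eq_graph ?_
  rw [← hT.isClosable.graph_closure_eq_closure_graph]
  exact hT.submodule_topologicalClosure_eq

/-- **The temperate-growth classes form a core of `A`** (Mathlib's `LinearPMap.HasCore`; Reed–Simon I
§VIII.2, Definition p. 256: `D ⊆ D(T)` is a core of the closed operator `T` if the closure of
`T|D` is `T`): `S ≤ dom A` and the closure of `A|S` is `A`. Indeed `A` is closed (self-adjoint),
`A|S ≤ A` is closable with closure `≤ A`, and every graph point `(f, A f)` is a limit of graph
points over Schwartz classes (`exists_schwartz_graph_approx`), so the domains agree; thus the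
self-adjoint `A` of CIP 1994 Thm 7.2.1 is the closure of `L` restricted to the functions of
temperate growth, on which (7.1.6) converges. [cite: CIPDiluteGases1994, §7.2 Thm 7.2.1] -/
theorem hasCore_linearizedHardSpherePMap (hE : 2 ≤ finrank ℝ E) :
    (linearizedHardSpherePMap hE).HasCore temperateSubmodule := by
  set A := linearizedHardSpherePMap hE with hA
  have hS : temperateSubmodule ≤ A.domain := temperateSubmodule_le_linearizedDomain
  have hclosed : A.IsClosed := (isSelfAdjoint_linearizedHardSpherePMap hE).isClosed
  have hBA : A.domRestrict temperateSubmodule ≤ A := LinearPMap.domRestrict_le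
  have hBc : (A.domRestrict temperateSubmodule).IsClosable := hclosed.isClosable.leIsClosable hBA
  have hle : (A.domRestrict temperateSubmodule).closure ≤ A := by
    have h := hclosed.isClosable.closure_mono hBA
    rwa [closure_eq_of_isClosed hclosed] at h
  refine ⟨hS, LinearPMap.eq_of_le_of_domain_eq hle (le_antisymm hle.1 fun f hf => ?_)⟩
  -- `(f, A f)` lies in the closure of the graph of `A|S`
  rw [LinearPMap.mem_domain_iff]
  refine ⟨A ⟨f, hf⟩, ?_⟩
  rw [← hBc.graph_closure_eq_closure_graph, ← SetLike.mem_coe, Submodule.topologicalClosure_coe,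
    Metric.mem_closure_iff]
  intro ε hε
  obtain ⟨s, hs1, hs2⟩ := exists_schwartz_graph_approx hE ⟨f, hf⟩ hε
  have hsdom : s.toLp 2 (stdGaussian E) ∈ (A.domRestrict temperateSubmodule).domain := by
    rw [LinearPMap.domRestrict_domain]
    exact ⟨schwartz_toLp_mem_temperateSubmodule s, schwartz_toLp_mem_linearizedDomain s⟩
  refine ⟨(s.toLp 2 (stdGaussian E),
    A (⟨s.toLp 2 (stdGaussian E), schwartz_toLp_mem_linearizedDomain s⟩ : linearizedDomain (E := E))),
    ?_, ?_⟩
  · rw [SetLike.mem_coe, LinearPMap.mem_graph_iff]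
    exact ⟨⟨s.toLp 2 (stdGaussian E), hsdom⟩, rfl, rfl⟩
  · rw [Prod.dist_eq, max_lt_iff, dist_eq_norm, dist_eq_norm, norm_sub_rev,
      norm_sub_rev (A ⟨f, hf⟩)]
    exact ⟨hs1, hs2⟩

end Core

end

end Literature.Analysis.UnboundedOperators
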